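import Literature.NumberTheory.Kottwitz1992.Involutions
import HarnessLib

/-!
# [Kottwitz1992, §2] Lemma 2.3 (1) — DISCHARGED: `Kottwitz1992_2_3_1_op_holds`

Kernel-lane companion of the statement carpet ★ `Literature/NumberTheory/Kottwitz1992/Involutions.lean` (squad TK, TK-t01): the named
fact ★ `Involutions.Kottwitz1992_2_3_1_op` — «If `*` is a positive involution of `B`, then it is also a positive involution of `B^opp`» — is
PROVED here as `theorem Kottwitz1992_2_3_1_op_holds : Kottwitz1992_2_3_1_op B ι`.  THEOREMS ONLY (no definition, no named fact, no `sorry`, no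
instance, no notation); cell hodgecm-mathlib, seat B-typ02 (g31); net debt −1.

R. E. Kottwitz, *Points on some Shimura varieties over finite fields*, J. Amer. Math. Soc. 5 (1992), §2 Lemma 2.3 (1), p. 380 (held
`paper:doi-10-2307-2152772`, p0008 L10–L19).  THE PRINTED PROOF: «For (1) simply note that `*` is an isomorphism of algebras with involution from
`B` to `B^opp`.»  Made explicit for the tree's rendering of «positive» (condition (3) of Lemma 2.2, ★ `IsPositiveInvolution`: `*` an involution
and `tr_{B/ℝ}(x x*) > 0` for `x ≠ 0`, `tr_{B/ℝ}` = ★ `Automorphic.leftMulTrace`): the `ℝ`-linear isomorphism `e : x ↦ (x*)^op`, `B → B^opp`,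
conjugates left multiplication by `c*` on `B` to left multiplication by `c^op` on `B^opp` (`leftMulTrace_op`: `tr_{B^opp/ℝ}(c^op) = tr_{B/ℝ}(c*)`,
Mathlib `LinearMap.trace_conj'`); for `x = a^op ≠ 0`, `x x^{*'} = (a* a)^op` and `(a* a)* = a* a**`, so `tr_{B^opp/ℝ}(x x^{*'}) = tr_{B/ℝ}(y y*)`
with `y = a* ≠ 0`, which is positive; the two involution identities transport through `op`/`unop`.  The standing hypothesis
`IsAlgebraWithInvolution` (finite-dimensional, semisimple) is not needed for this item and is not used.
HONEST LABEL: HC_CM is proved only modulo the 7 printed citations (2 remaining: hLiu418, h413) until rung 0 closes; this file adds no citation debt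
(0 facts, 0 sorry) and discharges 1 named fact of ★ `Involutions`.

## References
* [Kottwitz1992] R. E. Kottwitz, Points on some Shimura varieties over finite fields, J. Amer. Math. Soc. 5 (1992) 373–444, §2 Lemma 2.3 (1)
  p. 380; Lemma 2.2 (3) p. 379 (the positivity condition).
-/

noncomputable section

namespace Literature.NumberTheory.Kottwitz1992.Involutions

open MulOpposite
open Literature.NumberTheory.Automorphic (leftMulTrace leftMulTrace_apply)

universe u

variable {B : Type u} [Ring B] [Algebra ℝ B] (ι : B →ₗ[ℝ] B)

/-- The involution of `B^opp` induced by `*`: `(a^op)^{*'} = (a*)^op` (unfolding of the composite `op ∘ * ∘ unop`). [cite: Kottwitz1992, §2 Lemma 2.3 (1) p. 380] -/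
private theorem opInvolution_apply (x : Bᵐᵒᵖ) :
    ((opLinearEquiv ℝ).toLinearMap ∘ₗ ι ∘ₗ (opLinearEquiv ℝ (M := B)).symm.toLinearMap) x = op (ι (unop x)) := rfl

/-- **`tr_{B^opp/ℝ}(c^op) = tr_{B/ℝ}(c*)`** for an involution `*`: the `ℝ`-linear isomorphism `x ↦ (x*)^op : B → B^opp` («`*` is an isomorphism of
algebras with involution from `B` to `B^opp`») conjugates left multiplication by `c*` to left multiplication by `c^op`, and the trace is invariant
under conjugation. [cite: Kottwitz1992, §2 Lemma 2.3 (1) p. 380 (proof)] -/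
theorem leftMulTrace_op (hI : IsInvolution ℝ B ι) (c : B) :
    leftMulTrace ℝ Bᵐᵒᵖ (op c) = leftMulTrace ℝ B (ι c) := by
  let ιe : B ≃ₗ[ℝ] B := LinearEquiv.ofInvolutive ι hI.apply_apply
  let e : B ≃ₗ[ℝ] Bᵐᵒᵖ := ιe.trans (opLinearEquiv ℝ)
  have he : ∀ z : B, e z = op (ι z) := fun z => rfl
  have hsymm : ∀ y : Bᵐᵒᵖ, e.symm y = ι (unop y) := fun y => by
    rw [LinearEquiv.symm_apply_eq, he, hI.apply_apply, op_unop]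
  have hconj : e.conj (Algebra.lmul ℝ B (ι c)) = Algebra.lmul ℝ Bᵐᵒᵖ (op c) := by
    refine LinearMap.ext fun y => ?_
    rw [LinearEquiv.conj_apply_apply, hsymm, he]
    change op (ι (ι c * ι (unop y))) = op c * y
    rw [hI.map_mul, hI.apply_apply, hI.apply_apply, op_mul, op_unop]
  rw [leftMulTrace_apply, leftMulTrace_apply, ← hconj, LinearMap.trace_conj']

/-- **LEMMA 2.3 (1), PROVED**: ★ `Kottwitz1992_2_3_1_op` holds — «If `*` is a positive involution of `B`, then it is also a positive involution of
`B^opp`»: the involution identities pass through `op`, and `tr_{B^opp/ℝ}(a^op (a^op)^{*'}) = tr_{B^opp/ℝ}((a* a)^op) = tr_{B/ℝ}(a* a**) > 0` for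
`a ≠ 0` by `leftMulTrace_op` and the positivity of `*` at `a* ≠ 0`. [cite: Kottwitz1992, §2 Lemma 2.3 (1) p. 380] -/
theorem Kottwitz1992_2_3_1_op_holds : Kottwitz1992_2_3_1_op B ι := by
  intro _hA hP
  have hI : IsInvolution ℝ B ι := hP.toIsInvolution
  refine ⟨⟨fun x y => ?_, fun x => ?_⟩, fun x hx => ?_⟩
  · rw [opInvolution_apply, opInvolution_apply, opInvolution_apply, unop_mul, hI.map_mul, op_mul]
  · rw [opInvolution_apply, opInvolution_apply, unop_op, hI.apply_apply, op_unop]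
  · have ha : unop x ≠ 0 := fun h => hx (by rw [← op_unop x, h, op_zero])
    have hιa : ι (unop x) ≠ 0 := fun h => ha (by rw [← hI.apply_apply (unop x), h, map_zero])
    rw [opInvolution_apply]
    have hx' : x * op (ι (unop x)) = op (ι (unop x) * unop x) := by rw [op_mul, op_unop]
    rw [hx', leftMulTrace_op ι hI, hI.map_mul]
    exact hP.trace_mul_self_pos _ hιa

end Literature.NumberTheory.Kottwitz1992.Involutions

end
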